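import Summits.Ventures.Crystal3D.Theorems.StickyWulffConstantCoaxialWallLawJammedComparison
import Summits.Ventures.Crystal3D.Theorems.StickyWulffConstantCoaxialWallLawJammedCensusDefs
import Summits.Ventures.Crystal3D.Theorems.StickyWulffConstantCoaxialWallLawJammedCapping
import Summits.Ventures.Crystal3D.Theorems.StickyWulffConstantCoaxialWallLawOnSiteBridgeJoint
import Summits.Ventures.Crystal3D.Theorems.StickyWulffConstantCoaxialWallLawTailResidueMonoCapture
import HarnessLib

/-!
# THE U-A1 REDUCTION: `JammedOneCensus s → JammedOneSmall s k₀` (crux `CoaxialWallLaw`, stmt-Ventures-19481; line `WallLedgerF`,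
# skeleton 'CoaxialWallLawCertificates' v5, stub `stub_jammedOneSmall : TailResidue.JammedOneSmall (2√6) 3`)

HONEST FRAMING. Venture `Summits/Ventures/Crystal3D` (cell `crystal3d-full`), helper `--supports` the crux `CoaxialWallLaw` of
`route-Ventures-StickyWulffConstant` (REGISTERED line `WallLedgerF`, skeleton 'Certificates' v5, cf-p1 12:58Z).  Rung credit only; F-C1 not moved;
CONDITIONAL on the finite fact it consumes (`TailResidue.JammedOneCensus s`, `…JammedCensusDefs`; certificate owner cf-p2/eng).  The U-A1 stub of T5b
(«on-site window + ONE jammed ball of `≤ 3` contacts») follows from the census: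
* locality (radius `3`): `isEndPairA_congr_of_agree`, `endMultA_congr_of_agree`, `localSummandA_congr_of_agree`;
* `onSiteAt_of_module_insert` — if the transported jammed ball were a module point the window would be on-site (so `¬ OnSiteAt` puts it off the module);
* **`localSummandA_insert_le`** — model position: for `P ∈ 𝒰_cx` and an off-module, non-capping `x` with `≤ 3` contacts in `P`, the joint (A)-summand of
  `insert x P` at the payer is at most the lowered signature statistic of the census row that dominates (`…JammedComparison` + `dominate_joint_menu`), hence
  `≤ s` under the census clauses for the contact set `T = {p ∈ P : dist x p = 1}`;
* **`jammedOneSmall_of_census : JammedOneCensus s → JammedOneSmall s k₀`** (every `k₀`) — transport to model position, truncation to the radius-`3` window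
  (`= insert x̃ P`), non-capping from `¬ MonoModuleAt` (`monoModuleAt_of_capping`), realisability of `T` from the window, and the bound above;
  `jammedOneSmall_twoSqrtSix_of_census` — the instance of record.
WHAT THIS IS NOT: not the census (a finite computation over 𝒰_cx × contact sets); F-C1 not moved.
-/

noncomputable section

namespace Summit.Ventures.Crystal3D.Theorems

namespace TailResidue

open Summit.Ventures.Crystal3D Finset
open scoped InnerProductSpace

/-! ### Locality of (A)-end pairs and of the summand (radius `3` about the payer) -/

section Agree

variable {X Y : Finset (EuclideanSpace ℝ (Fin 3))} {c : EuclideanSpace ℝ (Fin 3)} {ρ : ℝ}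
  (h : ∀ x, dist c x ≤ ρ → (x ∈ X ↔ x ∈ Y)) {v : WordVersion} {S₁ S₂ : PlateSystem}
  (h₁ : S₁.RT ⊆ fccSlots) (h₂ : S₂.RT ⊆ fccSlots)

include h h₁ h₂ in
/-- (A)-end pairs of a ball `b` with `dist c b + 2 ≤ ρ` depend only on the balls within `ρ` of `c` (one direction). -/
theorem isEndPairA_of_agree {b q : EuclideanSpace ℝ (Fin 3)} (hb : dist c b + 2 ≤ ρ) (hp : IsEndPairA X v S₁ S₂ b q) :
    IsEndPairA Y v S₁ S₂ b q := by
  obtain ⟨hq, hbX, hpay, G, d, hadm, hqd, hmove⟩ := hp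
  have hd1 : ‖d‖ = 1 := norm_dir_eq_one h₁ h₂ hadm
  have hbq : dist b q = 1 := dist_eq_one_of_isEndMove hd1 hmove
  have hcq : dist c q ≤ dist c b + 1 := by linarith [dist_triangle c b q]
  have hqd' : dist q (q - d) = 1 := by rw [dist_eq_norm, sub_sub_cancel, hd1]
  have hcqd : dist c (q - d) ≤ dist c b + 2 := by linarith [dist_triangle c q (q - d)]
  exact ⟨(h q (by linarith)).1 hq, (h b (by linarith)).1 hbX, (hasTwoPayers_congr_of_agree h hb).1 hpay, G, d, hadm,
    (h _ (by linarith)).1 hqd, (isEndMove_congr_of_agree h v G hd1 (by linarith) (by linarith)).1 hmove⟩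

include h h₁ h₂ in
/-- (A)-end pairs of a ball `b` with `dist c b + 2 ≤ ρ` depend only on the balls within `ρ` of `c`. -/
theorem isEndPairA_congr_of_agree {b q : EuclideanSpace ℝ (Fin 3)} (hb : dist c b + 2 ≤ ρ) :
    IsEndPairA X v S₁ S₂ b q ↔ IsEndPairA Y v S₁ S₂ b q :=
  ⟨isEndPairA_of_agree h h₁ h₂ hb, isEndPairA_of_agree (fun x hx => (h x hx).symm) h₁ h₂ hb⟩

include h h₁ h₂ in
open scoped Classical in
/-- (A)-multiplicities agree. -/
theorem endMultA_congr_of_agree {b : EuclideanSpace ℝ (Fin 3)} (hb : dist c b + 2 ≤ ρ) : endMultA X v S₁ S₂ b = endMultA Y v S₁ S₂ b := by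
  unfold endMultA
  congr 1
  ext q
  simp only [mem_filter]
  constructor
  · rintro ⟨-, hp⟩
    have hp' := (isEndPairA_congr_of_agree h h₁ h₂ hb).1 hp
    exact ⟨hp'.1, hp'⟩
  · rintro ⟨-, hp⟩
    have hp' := (isEndPairA_congr_of_agree h h₁ h₂ hb).2 hp
    exact ⟨hp'.1, hp'⟩

include h h₁ h₂ in
open scoped Classical in
/-- **The (A)-summand at `z` depends only on the balls within `dist c z + 3` of `c`.** -/
theorem localSummandA_congr_of_agree {z : EuclideanSpace ℝ (Fin 3)} (hz : dist c z + 3 ≤ ρ) :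
    localSummandA v S₁ S₂ X z = localSummandA v S₁ S₂ Y z := by
  unfold localSummandA
  have hset : X.filter (fun b => dist z b ≤ 1 ∧ 0 < endMultA X v S₁ S₂ b) = Y.filter (fun b => dist z b ≤ 1 ∧ 0 < endMultA Y v S₁ S₂ b) := by
    ext b
    simp only [mem_filter]
    constructor
    · rintro ⟨hbX, hzb, hpos⟩
      have hcb : dist c b + 2 ≤ ρ := by linarith [dist_triangle c z b]
      exact ⟨(h b (by linarith)).1 hbX, hzb, by rwa [← endMultA_congr_of_agree h h₁ h₂ hcb]⟩
    · rintro ⟨hbY, hzb, hpos⟩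
      have hcb : dist c b + 2 ≤ ρ := by linarith [dist_triangle c z b]
      exact ⟨(h b (by linarith)).2 hbY, hzb, by rwa [endMultA_congr_of_agree h h₁ h₂ hcb]⟩
  rw [hset]
  refine sum_congr rfl fun b hb => ?_
  obtain ⟨-, hzb, -⟩ := mem_filter.1 hb
  have hcb : dist c b + 2 ≤ ρ := by linarith [dist_triangle c z b]
  rw [endMultA_congr_of_agree h h₁ h₂ hcb, pooledDef_congr_of_agree h hcb]

end Agree

/-! ### An on-site window plus a MODULE ball is on-site -/

/-- **If the transported jammed ball is a module point, the window is on-site.**  (So `¬ OnSiteAt` puts it off the module.) -/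
theorem onSiteAt_of_module_insert {X P : Finset (EuclideanSpace ℝ (Fin 3))} {z x : EuclideanSpace ℝ (Fin 3)}
    {S : EuclideanSpace ℝ (Fin 3) ≃ₗᵢ[ℝ] EuclideanSpace ℝ (Fin 3)} (hX : ∀ p ∈ X, ∀ q ∈ X, p ≠ q → 1 ≤ dist p q)
    (hdeg : (X.filter fun q => dist z q = 1).card ≤ 11) (hP : P ∈ coaxialModuleUniverse)
    (hwin : (X.erase x).filter (fun y => dist z y ≤ 3) = P.image fun p => S p + z) (hx : x ∈ X) (hzx : dist z x ≤ 3)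
    (hmod : S.symm x + -S.symm z ∈ coaxialModule 1 (Real.sqrt (2 / 3))) : OnSiteAt coaxialModuleUniverse X z := by
  classical
  set x' : EuclideanSpace ℝ (Fin 3) := S.symm x + -S.symm z with hx'
  have hSx' : S x' + z = x := by rw [hx']; simp
  -- pattern balls come from the window of `X.erase x`
  have hPX : ∀ p ∈ P, S p + z ∈ X.erase x ∧ dist z (S p + z) ≤ 3 := by
    intro p hp
    have : S p + z ∈ (X.erase x).filter fun y => dist z y ≤ 3 := by rw [hwin]; exact mem_image_of_mem _ hp
    exact ⟨(mem_filter.1 this).1, (mem_filter.1 this).2⟩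
  obtain ⟨hPsub, hPsep, hP0, hPdeg⟩ := hP
  set P' : Finset (EuclideanSpace ℝ (Fin 3)) := insert x' P with hP'
  have hmapX : ∀ p ∈ P', S p + z ∈ X := by
    intro p hp
    rcases mem_insert.1 hp with rfl | hp
    · rw [hSx']; exact hx
    · exact (mem_erase.1 (hPX p hp).1).2
  have hinj : Function.Injective fun p : EuclideanSpace ℝ (Fin 3) => S p + z := rigid_injective S z
  refine ⟨P', ⟨?_, ?_, ?_, ?_⟩, S, ?_⟩
  · -- inside the module and the closed ball
    intro p hp
    rcases mem_insert.1 (mem_coe.1 hp) with rfl | hp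
    · refine ⟨hmod, ?_⟩
      rw [Metric.mem_closedBall, dist_comm, hx', dist_zero_motion]; exact hzx
    · exact hPsub (mem_coe.2 hp)
  · -- `1`-separated: the placement maps `P'` injectively into `X`
    intro p hp q hq hpq
    rw [← dist_rigid S z p q]
    exact hX _ (hmapX p hp) _ (hmapX q hq) fun h' => hpq (hinj h')
  · exact mem_insert_of_mem hP0
  · -- the payer's degree
    have hsub : ∀ p ∈ P'.filter (fun q => dist (0 : EuclideanSpace ℝ (Fin 3)) q = 1), S p + z ∈ X.filter fun q => dist z q = 1 := by
      intro p hp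
      obtain ⟨hpP, hd⟩ := mem_filter.1 hp
      refine mem_filter.2 ⟨hmapX p hpP, ?_⟩
      rw [← dist_rigid S z 0 p, map_zero, zero_add] at hd; exact hd
    calc (P'.filter fun q => dist (0 : EuclideanSpace ℝ (Fin 3)) q = 1).card
        ≤ (X.filter fun q => dist z q = 1).card := card_le_card_of_injOn _ hsub (hinj.injOn)
      _ ≤ 11 := hdeg
  · -- the window equation
    ext y
    simp only [mem_filter, mem_image, hP', mem_insert]
    constructor
    · rintro ⟨hyX, hzy⟩
      by_cases hyx : y = x
      · exact ⟨x', Or.inl rfl, by rw [hSx', hyx]⟩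
      · have : y ∈ (X.erase x).filter fun y => dist z y ≤ 3 := mem_filter.2 ⟨mem_erase.2 ⟨hyx, hyX⟩, hzy⟩
        rw [hwin] at this
        obtain ⟨p, hp, rfl⟩ := mem_image.1 this
        exact ⟨p, Or.inr hp, rfl⟩
    · rintro ⟨p, hp | hp, rfl⟩
      · subst hp; rw [hSx']; exact ⟨hx, hzx⟩
      · exact ⟨(mem_erase.1 (hPX p hp).1).2, (hPX p hp).2⟩

/-! ### The bound in model position -/

/-- Basal systems have slot roots. -/
theorem basalSystem_roots (L : EuclideanSpace ℝ (Fin 3) ≃ₗᵢ[ℝ] EuclideanSpace ℝ (Fin 3)) : (basalSystem L).RT ⊆ fccSlots :=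
  fun _ hr => (mem_filter.1 hr).1

open scoped Classical in
/-- Signature domination bounds (A)-multiplicities by signature multiplicities on the same configuration. -/
theorem endMultA_le_endMultSig_of_dom {P : Finset (EuclideanSpace ℝ (Fin 3))} {v : WordVersion} {S₁ S₂ : PlateSystem}
    {sig : Finset (Bool × EuclideanSpace ℝ (Fin 3))}
    (hdom : ∀ b q : EuclideanSpace ℝ (Fin 3), dist (0 : EuclideanSpace ℝ (Fin 3)) b ≤ 1 → IsEndPairA P v S₁ S₂ b q → IsEndPairSig P v sig b q)
    {b : EuclideanSpace ℝ (Fin 3)} (hb : dist (0 : EuclideanSpace ℝ (Fin 3)) b ≤ 1) : endMultA P v S₁ S₂ b ≤ endMultSig P v sig b := by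
  unfold endMultA endMultSig
  exact card_le_card fun q hq => mem_filter.2 ⟨(mem_filter.1 hq).1, hdom b q hb (mem_filter.1 hq).2⟩

open scoped Classical in
/-- **THE BOUND IN MODEL POSITION.**  For a pattern `P ∈ 𝒰_cx` and a point `x` off the module, at distance `≥ 1` from `P`, touching `≤ 3` balls of `P` and
not capping, the joint (A)-summand of `insert x P` at the payer `0` is `≤ s` under the census clauses for the contact set `{p ∈ P : dist x p = 1}`. -/
theorem localSummandA_insert_le {P : Finset (EuclideanSpace ℝ (Fin 3))} {x : EuclideanSpace ℝ (Fin 3)}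
    (L' : EuclideanSpace ℝ (Fin 3) ≃ₗᵢ[ℝ] EuclideanSpace ℝ (Fin 3)) {s : ℝ} (hP : P ∈ coaxialModuleUniverse)
    (hxoff : x ∉ coaxialModule 1 (Real.sqrt (2 / 3))) (hsep : ∀ p ∈ P, 1 ≤ dist x p)
    (hfew : (P.filter fun q => dist x q = 1).card ≤ 3)
    (hcap : ∀ t₁ ∈ P, ∀ t₂ ∈ P, ∀ t₃ ∈ P, dist t₁ t₂ = 1 → dist t₁ t₃ = 1 → dist t₂ t₃ = 1 →
      dist x t₁ = 1 → dist x t₂ = 1 → dist x t₃ = 1 → False)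
    (hpos : ∀ b ∈ P, dist (0 : EuclideanSpace ℝ (Fin 3)) b ≤ 1 → 0 < lowPool P (P.filter fun q => dist x q = 1) b)
    (htr : ∀ ε : Bool, ∀ n ∈ modelNormals, localStatSigLow P (P.filter fun q => dist x q = 1) WordVersion.v2 (transSigs ε n) 0 ≤ s)
    (hj : localStatSigLow P (P.filter fun q => dist x q = 1) WordVersion.v2 jointSigs 0 ≤ s) :
    localSummandA WordVersion.v2 (basalSystem L')
      (basalSystem (((ℝ ∙ EuclideanSpace.single (2 : Fin 3) (1 : ℝ)).reflection).trans L')) (insert x P) 0 ≤ s := by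
  set T := P.filter (fun q => dist x q = 1) with hT
  set Y := insert x P with hY
  set S₁ := basalSystem L' with hS₁
  set S₂ := basalSystem (((ℝ ∙ EuclideanSpace.single (2 : Fin 3) (1 : ℝ)).reflection).trans L') with hS₂
  have hPmod := mem_coaxialModule_of_mem_universe hP
  have hxP : x ∉ P := fun h => hxoff (hPmod x h)
  have hYerase : Y.erase x = P := by rw [hY, erase_insert hxP]
  obtain ⟨hPsub, hPsep, -, -⟩ := hP
  -- hypotheses of the comparison
  have hY1 : ∀ p ∈ Y, ∀ q ∈ Y, p ≠ q → 1 ≤ dist p q := by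
    intro p hp q hq hpq
    rcases mem_insert.1 hp with hpx | hpP
    · rcases mem_insert.1 hq with hqx | hqP
      · exact absurd (hpx.trans hqx.symm) hpq
      · rw [hpx]; exact hsep q hqP
    · rcases mem_insert.1 hq with hqx | hqP
      · rw [hqx, dist_comm]; exact hsep p hpP
      · exact hPsep p hpP q hqP hpq
  have hmod : ∀ y ∈ Y, dist (0 : EuclideanSpace ℝ (Fin 3)) y ≤ 3 → y ≠ x → y ∈ coaxialModule 1 (Real.sqrt (2 / 3)) := by
    intro y hy _ hyx
    rcases mem_insert.1 hy with h | h
    · exact absurd h hyx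
    · exact hPmod y h
  have hfewY : (Y.filter fun q => dist x q = 1).card ≤ 3 := by
    have : Y.filter (fun q => dist x q = 1) = T := by
      rw [hY, filter_insert, if_neg (by rw [dist_self]; norm_num), hT]
    rw [this]; exact hfew
  have hcapY : ∀ t₁ ∈ Y, ∀ t₂ ∈ Y, ∀ t₃ ∈ Y, dist t₁ t₂ = 1 → dist t₁ t₃ = 1 → dist t₂ t₃ = 1 →
      dist x t₁ = 1 → dist x t₂ = 1 → dist x t₃ = 1 → False := by
    intro t₁ ht₁ t₂ ht₂ t₃ ht₃ d12 d13 d23 e1 e2 e3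
    have mem : ∀ {t}, t ∈ Y → dist x t = 1 → t ∈ P := by
      intro t ht e
      rcases mem_insert.1 ht with rfl | ht
      · rw [dist_self] at e; exact absurd e zero_ne_one
      · exact ht
    exact hcap t₁ (mem ht₁ e1) t₂ (mem ht₂ e2) t₃ (mem ht₃ e3) d12 d13 d23 e1 e2 e3
  -- the lowered pools of the comparison are `lowPool P T`
  have hD : ∀ b ∈ P, pooledDef P b - ((P.filter fun y => dist x y = 1 ∧ dist b y ≤ 1).card : ℝ) + (if dist b x ≤ 1 then (9 : ℝ) else 0) =
      lowPool P T b := by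
    intro b hb
    unfold lowPool contactCount
    have hc : T.filter (fun t => dist b t ≤ 1) = P.filter fun y => dist x y = 1 ∧ dist b y ≤ 1 := by rw [hT, filter_filter]
    have hiff : dist b x ≤ 1 ↔ b ∈ T := by
      rw [hT, mem_filter, dist_comm]
      constructor
      · intro h; exact ⟨hb, le_antisymm h (hsep b hb)⟩
      · rintro ⟨-, h⟩; exact h.le
    rw [hc]
    by_cases hbT : b ∈ T
    · rw [if_pos hbT, if_pos (hiff.2 hbT)]
    · rw [if_neg hbT, if_neg (fun h => hbT (hiff.1 h))]
  have hposY : ∀ b ∈ Y.erase x, dist (0 : EuclideanSpace ℝ (Fin 3)) b ≤ 1 →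
      0 < pooledDef (Y.erase x) b - (((Y.erase x).filter fun y => dist x y = 1 ∧ dist b y ≤ 1).card : ℝ) +
        (if dist b x ≤ 1 then (9 : ℝ) else 0) := by
    rw [hYerase]
    intro b hb hb1
    rw [hD b hb]; exact hpos b hb hb1
  -- the comparison
  have hcmp := localSummandA_le_of_jammed_module (v := WordVersion.v2) hY1 (basalSystem_roots _) (basalSystem_roots _) hmod hxoff hfewY hcapY
    (mem_insert_self x P) hposY (S₁ := S₁) (S₂ := S₂)
  rw [hYerase] at hcmp
  refine hcmp.trans ?_
  -- domination on the pattern itself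
  have hPW : ∀ y ∈ P, dist (0 : EuclideanSpace ℝ (Fin 3)) y ≤ 3 → y ∈ coaxialModule 1 (Real.sqrt (2 / 3)) := fun y hy _ => hPmod y hy
  have bound : ∀ {sig : Finset (Bool × EuclideanSpace ℝ (Fin 3))},
      (∀ b q : EuclideanSpace ℝ (Fin 3), dist (0 : EuclideanSpace ℝ (Fin 3)) b ≤ 1 → IsEndPairA P WordVersion.v2 S₁ S₂ b q →
        IsEndPairSig P WordVersion.v2 sig b q) →
      ∑ b ∈ P.filter (fun b => dist (0 : EuclideanSpace ℝ (Fin 3)) b ≤ 1 ∧ 0 < endMultA P WordVersion.v2 S₁ S₂ b),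
          (endMultA P WordVersion.v2 S₁ S₂ b : ℝ) /
            (pooledDef P b - ((P.filter fun y => dist x y = 1 ∧ dist b y ≤ 1).card : ℝ) + (if dist b x ≤ 1 then (9 : ℝ) else 0)) ≤
        localStatSigLow P T WordVersion.v2 sig 0 := by
    intro sig hdom
    unfold localStatSigLow
    set A := P.filter (fun b => dist (0 : EuclideanSpace ℝ (Fin 3)) b ≤ 1 ∧ 0 < endMultA P WordVersion.v2 S₁ S₂ b) with hA
    set B := P.filter (fun b => dist (0 : EuclideanSpace ℝ (Fin 3)) b ≤ 1 ∧ 0 < endMultSig P WordVersion.v2 sig b) with hB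
    have step : ∀ b ∈ A, b ∈ B ∧ (endMultA P WordVersion.v2 S₁ S₂ b : ℝ) /
        (pooledDef P b - ((P.filter fun y => dist x y = 1 ∧ dist b y ≤ 1).card : ℝ) + (if dist b x ≤ 1 then (9 : ℝ) else 0)) ≤
        (endMultSig P WordVersion.v2 sig b : ℝ) / lowPool P T b := by
      intro b hb
      obtain ⟨hbP, hb1, hepos⟩ := mem_filter.1 hb
      have hle := endMultA_le_endMultSig_of_dom hdom hb1
      refine ⟨mem_filter.2 ⟨hbP, hb1, lt_of_lt_of_le hepos hle⟩, ?_⟩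
      rw [hD b hbP]
      exact div_le_div_of_nonneg_right (by exact_mod_cast hle) (hpos b hbP hb1).le
    calc ∑ b ∈ A, (endMultA P WordVersion.v2 S₁ S₂ b : ℝ) /
            (pooledDef P b - ((P.filter fun y => dist x y = 1 ∧ dist b y ≤ 1).card : ℝ) + (if dist b x ≤ 1 then (9 : ℝ) else 0))
        ≤ ∑ b ∈ A, (endMultSig P WordVersion.v2 sig b : ℝ) / lowPool P T b := sum_le_sum fun b hb => (step b hb).2
      _ ≤ ∑ b ∈ B, (endMultSig P WordVersion.v2 sig b : ℝ) / lowPool P T b :=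
          sum_le_sum_of_subset_of_nonneg (fun b hb => (step b hb).1) fun b hb _ =>
            div_nonneg (Nat.cast_nonneg _) (hpos b (mem_filter.1 hb).1 (mem_filter.1 hb).2.1).le
  rcases dominate_joint_menu (v := WordVersion.v2) coaxialModule_menu hPW L' basalHexagon subset_rfl with ⟨ε, n, hn, hdom⟩ | hdom
  · exact (bound hdom).trans (htr ε n hn)
  · exact (bound hdom).trans hj


/-! ### The reduction -/

open scoped Classical in
/-- **THE U-A1 REDUCTION: `JammedOneCensus s → JammedOneSmall s k₀`.**  At an off-site, non-mono-module payer window of the U-A1 shape (an on-site 𝒰_cx window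
plus one ball `x` of `≤ 3` contacts): `x` is off the module (else the window would be on-site) and not capping (else the window would be mono-module), so the
comparison of `…JammedComparison`, the on-site domination and the census bound the joint (A)-summand by `s`. -/
theorem jammedOneSmall_of_census {s : ℝ} (hcen : JammedOneCensus s) (k₀ : ℕ) : JammedOneSmall s k₀ := by
  intro L X hX z _ hdeg hoff hM _ hJ
  obtain ⟨x, hx, _, hfew, P, hP, S, hwin⟩ := hJ
  right
  set H : EuclideanSpace ℝ (Fin 3) ≃ₗᵢ[ℝ] EuclideanSpace ℝ (Fin 3) := (ℝ ∙ EuclideanSpace.single (2 : Fin 3) (1 : ℝ)).reflection with hH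
  set x' : EuclideanSpace ℝ (Fin 3) := S.symm x + -S.symm z with hx'
  have hzx : dist z x ≤ 3 := dist_le_three_of_jammedOneAt hoff ⟨P, hP, S, hwin⟩
  have hx'off : x' ∉ coaxialModule 1 (Real.sqrt (2 / 3)) := fun h => hoff (onSiteAt_of_module_insert hX hdeg hP hwin hx hzx h)
  have hagree := onSite_window_agree hwin
  have hSx' : S x' + z = x := by rw [hx']; simp
  have hPX : ∀ p ∈ P, S p + z ∈ X.erase x := fun p hp => by
    have : S p + z ∈ (X.erase x).filter fun y => dist z y ≤ 3 := by rw [hwin]; exact mem_image_of_mem _ hp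
    exact (mem_filter.1 this).1
  have hsep : ∀ p ∈ P, 1 ≤ dist x' p := by
    intro p hp
    obtain ⟨hne, hpX⟩ := mem_erase.1 (hPX p hp)
    rw [← dist_rigid S z x' p, hSx']
    exact hX x hx _ hpX (Ne.symm hne)
  have hfewP : (P.filter fun q => dist x' q = 1).card ≤ 3 := by
    refine le_trans (card_le_card_of_injOn (fun p => S p + z) (fun p hp => ?_) (rigid_injective S z).injOn) hfew
    obtain ⟨hpP, hd⟩ := mem_filter.1 hp
    refine mem_filter.2 ⟨(mem_erase.1 (hPX p hpP)).2, ?_⟩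
    rw [← hSx', dist_rigid]; exact hd
  have hx'3 : dist (0 : EuclideanSpace ℝ (Fin 3)) x' ≤ 3 := by rw [hx', dist_zero_motion]; exact hzx
  have hcapP : ∀ t₁ ∈ P, ∀ t₂ ∈ P, ∀ t₃ ∈ P, dist t₁ t₂ = 1 → dist t₁ t₃ = 1 → dist t₂ t₃ = 1 →
      dist x' t₁ = 1 → dist x' t₂ = 1 → dist x' t₃ = 1 → False :=
    fun t₁ ht₁ t₂ ht₂ t₃ ht₃ d12 d13 d23 e1 e2 e3 => hM (monoModuleAt_of_capping hP hwin hx hzx hx'off ht₁ ht₂ ht₃ d12 d13 d23 e1 e2 e3)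
  -- the census instance at the contact set of `x'`
  have hreal : JammedRealisable P (P.filter fun q => dist x' q = 1) :=
    ⟨x', hx'off, hx'3, hsep, rfl, hfewP, fun t₁ ht₁ t₂ ht₂ t₃ ht₃ d12 d13 d23 =>
      hcapP t₁ (mem_filter.1 ht₁).1 t₂ (mem_filter.1 ht₂).1 t₃ (mem_filter.1 ht₃).1 d12 d13 d23 (mem_filter.1 ht₁).2 (mem_filter.1 ht₂).2
        (mem_filter.1 ht₃).2⟩
  obtain ⟨hpos, htr, hj⟩ := hcen P hP _ hreal
  have key := localSummandA_insert_le (L.trans S.symm) hP hx'off hsep hfewP hcapP hpos htr hj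
  -- transport to model position and truncation to the radius-`3` window `insert x' P`
  have htrans := localSummandA_transport X S.symm (-S.symm z) WordVersion.v2 L (H.trans L) basalHexagon basalHexagon z
  have hz0 : S.symm z + -S.symm z = 0 := add_neg_cancel _
  have hassoc : (H.trans L).trans S.symm = H.trans (L.trans S.symm) := LinearIsometryEquiv.ext fun _ => rfl
  have hwin' : ∀ y, dist (0 : EuclideanSpace ℝ (Fin 3)) y ≤ 3 → (y ∈ X.image (fun y => S.symm y + -S.symm z) ↔ y ∈ insert x' P) := by
    intro y hy
    rw [mem_insert]
    constructor
    · intro hyX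
      obtain ⟨y₀, hy₀, rfl⟩ := mem_image.1 hyX
      by_cases h0 : y₀ = x
      · left; rw [h0]
      · right; exact (hagree _ hy).1 (mem_image_of_mem _ (mem_erase.2 ⟨h0, hy₀⟩))
    · rintro (rfl | hyP)
      · exact mem_image_of_mem _ hx
      · exact image_subset_image (erase_subset _ _) ((hagree _ hy).2 hyP)
  have hloc := localSummandA_congr_of_agree hwin' (v := WordVersion.v2) (basalSystem_roots (L.trans S.symm))
    (basalSystem_roots (H.trans (L.trans S.symm))) (z := 0) (by rw [dist_self]; norm_num)
  have h1 : localSummandA WordVersion.v2 (basalSystem L) (basalSystem (H.trans L)) X z =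
      localSummandA WordVersion.v2 (basalSystem (L.trans S.symm)) (basalSystem (H.trans (L.trans S.symm)))
        (X.image fun y => S.symm y + -S.symm z) 0 := by
    unfold basalSystem
    rw [← htrans, hz0, hassoc]
  rw [h1, hloc]
  exact key

/-- **The instance of record**: `JammedOneCensus (2√6) → JammedOneSmall (2√6) 3` (the registered v5 stub `stub_jammedOneSmall`, modulo the finite census). -/
theorem jammedOneSmall_twoSqrtSix_of_census (hcen : JammedOneCensus (2 * Real.sqrt 6)) : JammedOneSmall (2 * Real.sqrt 6) 3 :=
  jammedOneSmall_of_census hcen 3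

end TailResidue

end Summit.Ventures.Crystal3D.Theorems

end
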